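import Literature.NumberTheory.Automorphic.CompactCoreLevel
import Literature.NumberTheory.Automorphic.UnitaryGroupOrbitalMeasureFamilyOfLocal
import Literature.MeasureTheory.Group.InvariantQuotientTransport
import HarnessLib

/-!
# Mass one AT THE POINT: a canonical orbital measure family read at `γ` (`atPoint`) gives the orbit
# `π(K)` mass one when the compact core of `Z(γ)` lies in `K` — and the (viii′-3) discharge
# `∃ S₀, IsNormalisedOff` for unitary groups
(Rogawski (1990), §4.3 p. 43; Deitmar–Echterhoff (2014), Thm. 1.5.3)

Topic `NumberTheory/Automorphic`; namespace `Literature.NumberTheory.Automorphic`. THEOREMS ONLY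
(no definition, no named fact, no instance, no notation). Continuation of `CompactCoreLevel` (F4-a):
there the mass-one statement is proved at the class REPRESENTATIVE `out c` where the canonical
normalising Haar measure lives (`OrbitalMeasureFamily.IsCanonical.apply_image_mk_eq_one`); here it
is transported to the point `γ` itself along the conjugator `conjOut γ` of ★
`OrbitalMeasureFamily.atPoint` (`UnitaryGroupOrbitalMeasureFamilyOfLocal`, F0P3a-p06 Q4-C2):

* `map_mulAutConj_eq_self` — a left and right invariant measure is invariant under conjugation;
* `OrbitalMeasureFamily.IsCanonical.atPoint_eq_quotientMeasure` — for a canonical `m` (for `(P, ν)`)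
  and `γ` with `P (out ⟦γ⟧)`, `m.atPoint γ = ν/t'` with `t'` the transported Haar measure on `Z(γ)`,
  again of mass one on the compact core (★ `map_cosetCongr_quotientMeasure`, ★ `image_compactCore`);
* `OrbitalMeasureFamily.IsCanonical.atPoint_image_mk_eq_one` — **`m.atPoint γ (π(K)) = 1`** for a
  compact open subgroup `K` with `ν(K) = 1` and `compactCore Z(γ) ⊆ K`;
* `UnitaryGroup.exists_isNormalisedOff_of_isCanonical` — **the (viii′-3) discharge**: for local
  families `mG v` canonical for `(P_v, ν_v)` with `ν_v(K_v) = 1`, the named fact ★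
  `CompactCoreCentralizerLevelAE` (F4-a) and a rational regular `γ` whose local class representatives
  satisfy `P_v`, there is a finite `S₀` with ★ `UnitaryGroup.IsNormalisedOff L N H mG (toAdelic γ) S₀` —
  literally the guard of ★ `AdelicOrbitalMeasureFamily.ofLocal_eq` ∕ `_admissible` ∕
  `adelicClassOrbitalIntegral_ofLocal_eval_eq_mul_prod`.

## References

* J. D. Rogawski, *Automorphic Representations of Unitary Groups in Three Variables* (1990), §4.3
  p. 43 [Rogawski1990].
* A. Deitmar, S. Echterhoff, *Principles of Harmonic Analysis*, 2nd ed. (2014), Thm. 1.5.3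
  [DeitmarEchterhoff2014].
-/

noncomputable section

open MeasureTheory Measure Set NumberField IsDedekindDomain
open Literature.MeasureTheory.Group
open scoped ENNReal NNReal

namespace Literature.NumberTheory.Automorphic

/-! ## §1 Conjugation invariance of a two-sided Haar measure -/

section Conj

variable {G : Type*} [Group G] [MeasurableSpace G] [MeasurableMul G]

/-- A left and right invariant measure is invariant under the inner automorphism `g ↦ x g x⁻¹`.
[cite: DeitmarEchterhoff2014, Thm. 1.5.3] -/
theorem map_mulAutConj_eq_self (ν : Measure G) [ν.IsMulLeftInvariant] [ν.IsMulRightInvariant] (x : G) :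
    Measure.map (MulAut.conj x : G ≃* G) ν = ν := by
  have h : ((MulAut.conj x : G ≃* G) : G → G) = (fun g => g * x⁻¹) ∘ fun g => x * g := by
    funext g; simp [MulAut.conj_apply]
  rw [h, ← Measure.map_map (measurable_mul_const x⁻¹) (measurable_const_mul x), map_mul_left_eq_self,
    map_mul_right_eq_self]

end Conj

/-! ## §2 Canonical families read at a point -/

section AtPoint

variable {G : Type*} [Group G] [TopologicalSpace G] [IsTopologicalGroup G] [LocallyCompactSpace G]
  [SecondCountableTopology G] [T2Space G] [MeasurableSpace G] [BorelSpace G]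
  [∀ γ : G, MeasurableSpace (G ⧸ Subgroup.centralizer ({γ} : Set G))]
  [∀ γ : G, BorelSpace (G ⧸ Subgroup.centralizer ({γ} : Set G))]

/-- **A canonical family read at `γ` is a canonical quotient measure at `γ`**: if `m` is canonical for
`(P, ν)` and `P (out ⟦γ⟧)`, then `m.atPoint γ = ν/t'` for a Haar measure `t'` on `Z(γ)` which is
inversion invariant and gives the compact core of `Z(γ)` mass one (transport of the normalising
measure on `Z(out ⟦γ⟧)` along `conj (conjOut γ)`: ★ `map_cosetCongr_quotientMeasure`,
★ `image_compactCore`, `map_mulAutConj_eq_self`). [cite: DeitmarEchterhoff2014, Thm. 1.5.3]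
[cite: Rogawski1990, §4.3 (p. 43)] -/
theorem OrbitalMeasureFamily.IsCanonical.atPoint_eq_quotientMeasure {P : G → Prop} {ν : Measure G}
    [ν.IsHaarMeasure] [ν.IsMulRightInvariant] {m : OrbitalMeasureFamily G} (hm : m.IsCanonical P ν)
    (γ : G) (hc : P (Quotient.out (ConjClasses.mk γ))) :
    ∃ t' : Measure (Subgroup.centralizer ({γ} : Set G)),
      ∃ (_ : t'.IsHaarMeasure) (_ : t'.IsInvInvariant),
        t' (compactCore (Subgroup.centralizer ({γ} : Set G))) = 1 ∧
          m.atPoint γ = quotientMeasure (Subgroup.centralizer ({γ} : Set G)) t'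
            (isClosed_coe_centralizer_singleton γ) ν := by
  obtain ⟨t, ht, hti, h1, hmc⟩ := hm _ hc
  -- the conjugator `φ = conj (conjOut γ)` with `φ (out ⟦γ⟧) = γ` maps `Z = Z(out ⟦γ⟧)` onto `Z' = Z(γ)`
  have hφγ : (MulAut.conj (conjOut γ) : G ≃* G) (Quotient.out (ConjClasses.mk γ)) = γ := conj_conjOut_out γ
  have hZZ' : ∀ g, (MulAut.conj (conjOut γ) : G ≃* G) g ∈ Subgroup.centralizer ({γ} : Set G) ↔
      g ∈ Subgroup.centralizer ({(Quotient.out (ConjClasses.mk γ) : G)} : Set G) :=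
    forall_apply_mem_centralizer_singleton_iff_of_eq (MulAut.conj (conjOut γ)) hφγ
  have he : Continuous (MulAut.conj (conjOut γ) : G ≃* G) := continuous_mulAutConj (conjOut γ)
  have hes : Continuous (MulAut.conj (conjOut γ) : G ≃* G).symm := continuous_mulAutConj_symm (conjOut γ)
  haveI hZc : IsClosed ((Subgroup.centralizer ({(Quotient.out (ConjClasses.mk γ) : G)} : Set G) : Subgroup G) : Set G) :=
    isClosed_coe_centralizer_singleton _
  haveI hZ'c : IsClosed ((Subgroup.centralizer ({γ} : Set G) : Subgroup G) : Set G) :=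
    isClosed_coe_centralizer_singleton γ
  haveI : LocallyCompactSpace (Subgroup.centralizer ({(Quotient.out (ConjClasses.mk γ) : G)} : Set G)) :=
    hZc.isClosedEmbedding_subtypeVal.locallyCompactSpace
  haveI : SecondCountableTopology (Subgroup.centralizer ({(Quotient.out (ConjClasses.mk γ) : G)} : Set G)) :=
    TopologicalSpace.Subtype.secondCountableTopology _
  haveI : LocallyCompactSpace (Subgroup.centralizer ({γ} : Set G)) :=
    hZ'c.isClosedEmbedding_subtypeVal.locallyCompactSpace
  haveI : SecondCountableTopology (Subgroup.centralizer ({γ} : Set G)) :=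
    TopologicalSpace.Subtype.secondCountableTopology _
  -- the restriction `Z ≃ Z'`, as a homeomorphism and as a continuous multiplicative equivalence
  let eH : Subgroup.centralizer ({(Quotient.out (ConjClasses.mk γ) : G)} : Set G) ≃ₜ
      Subgroup.centralizer ({γ} : Set G) :=
    subgroupCongrHomeomorph (MulAut.conj (conjOut γ) : G ≃* G) _ _ hZZ' he hes
  let eZ : Subgroup.centralizer ({(Quotient.out (ConjClasses.mk γ) : G)} : Set G) ≃ₜ*
      Subgroup.centralizer ({γ} : Set G) :=
    { toMulEquiv :=
        { toEquiv := eH.toEquiv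
          map_mul' := fun a b => Subtype.ext
            (map_mul (MulAut.conj (conjOut γ) : G ≃* G) (a : G) (b : G)) }
      continuous_toFun := eH.continuous
      continuous_invFun := eH.symm.continuous }
  have heZ : (eZ : _ → Subgroup.centralizer ({γ} : Set G)) = eH := rfl
  -- the transported normalising measure `t' = (eH)_* t`
  haveI ht'1 : (Measure.map eH t).IsHaarMeasure :=
    MulEquiv.isHaarMeasure_map t eZ.toMulEquiv eZ.continuous eZ.symm.continuous
  haveI ht'2 : (Measure.map eH t).IsInvInvariant :=
    isInvInvariant_map_mulEquiv eZ.toMulEquiv eZ.continuous.measurable t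
  refine ⟨Measure.map eH t, ht'1, ht'2, ?_, ?_⟩
  · -- mass one on the compact core, by transport
    rw [← Homeomorph.toMeasurableEquiv_coe, MeasurableEquiv.map_apply]
    have himg : (eZ : _ → Subgroup.centralizer ({γ} : Set G)) '' compactCore _ =
        compactCore (Subgroup.centralizer ({γ} : Set G)) := image_compactCore eZ
    have hpre : (eH : _ → Subgroup.centralizer ({γ} : Set G)) ⁻¹'
        compactCore (Subgroup.centralizer ({γ} : Set G)) =
          compactCore (Subgroup.centralizer ({(Quotient.out (ConjClasses.mk γ) : G)} : Set G)) := by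
      rw [← heZ, Set.preimage_eq_iff_eq_image eZ.bijective, himg]
    rw [Homeomorph.toMeasurableEquiv_coe, hpre, h1]
  · -- the measure at the point is the transported quotient measure
    have hmap := map_cosetCongr_quotientMeasure (MulAut.conj (conjOut γ) : G ≃* G) he hes _ _ hZZ'
      t (Measure.map eH t) ν ν rfl (map_mulAutConj_eq_self ν (conjOut γ)).symm
    unfold OrbitalMeasureFamily.atPoint
    rw [hmc]
    exact hmap

/-- **Mass one at the point**: a canonical family for `(P, ν)`, read at `γ` with `P (out ⟦γ⟧)`, gives
the orbit `π(K) ⊆ G ⧸ Z(γ)` of a compact open subgroup `K` with `ν(K) = 1` mass ONE as soon as the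
compact core of `Z(γ)` lies in `K` (★ F4-a `quotientMeasure_image_mk_eq_one_of_compactCore_subset`).
[cite: Rogawski1990, §4.3 (p. 43)] [cite: DeitmarEchterhoff2014, Thm. 1.5.3] -/
theorem OrbitalMeasureFamily.IsCanonical.atPoint_image_mk_eq_one {P : G → Prop} {ν : Measure G}
    [ν.IsHaarMeasure] [ν.IsMulRightInvariant] {m : OrbitalMeasureFamily G} (hm : m.IsCanonical P ν)
    (γ : G) (hc : P (Quotient.out (ConjClasses.mk γ))) (K : Subgroup G) (hK : IsOpen (K : Set G))
    (hKc : IsCompact (K : Set G)) (hν : ν K = 1)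
    (h : compactCore (Subgroup.centralizer ({γ} : Set G)) ⊆ Subtype.val ⁻¹' (K : Set G)) :
    m.atPoint γ ((QuotientGroup.mk : G → G ⧸ Subgroup.centralizer ({γ} : Set G)) '' (K : Set G)) = 1 := by
  obtain ⟨t', ht', hti', h1, hat⟩ := hm.atPoint_eq_quotientMeasure γ hc
  haveI : IsClosed ((Subgroup.centralizer ({γ} : Set G) : Subgroup G) : Set G) :=
    isClosed_coe_centralizer_singleton γ
  haveI : LocallyCompactSpace (Subgroup.centralizer ({γ} : Set G)) :=
    (isClosed_coe_centralizer_singleton γ).isClosedEmbedding_subtypeVal.locallyCompactSpace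
  haveI : SecondCountableTopology (Subgroup.centralizer ({γ} : Set G)) :=
    TopologicalSpace.Subtype.secondCountableTopology _
  rw [hat]
  exact quotientMeasure_image_mk_eq_one_of_compactCore_subset _ t' ν K hK hKc hν h1 h

end AtPoint

/-! ## §3 The (viii′-3) discharge for unitary groups -/

namespace UnitaryGroup

variable (L : Type) [Field L] [NumberField L] [IsCMField L] (N : ℕ) (H : Matrix (Fin N) (Fin N) L)
  [∀ (v : HeightOneSpectrum (𝓞 ↥(maximalRealSubfield L))) (x : (cmDatum L N H).Local v),
    MeasurableSpace ((cmDatum L N H).Local v ⧸ Subgroup.centralizer ({x} : Set ((cmDatum L N H).Local v)))]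
  [∀ (v : HeightOneSpectrum (𝓞 ↥(maximalRealSubfield L))) (x : (cmDatum L N H).Local v),
    BorelSpace ((cmDatum L N H).Local v ⧸ Subgroup.centralizer ({x} : Set ((cmDatum L N H).Local v)))]
  [∀ v : HeightOneSpectrum (𝓞 ↥(maximalRealSubfield L)), MeasurableSpace ((cmDatum L N H).Local v)]
  [∀ v : HeightOneSpectrum (𝓞 ↥(maximalRealSubfield L)), BorelSpace ((cmDatum L N H).Local v)]
  [∀ v : HeightOneSpectrum (𝓞 ↥(maximalRealSubfield L)), SecondCountableTopology ((cmDatum L N H).Local v)]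

/-- **The (viii′-3) discharge**: let `mG v` be local orbital measure families, canonical for
`(P v, νG v)` with Haar measures `νG v` giving the levels `K_v = cmLocalIntegralLevel L N H v` mass one.
If the named fact ★ `CompactCoreCentralizerLevelAE L N H` holds and `γ ∈ U(H)(L⁺)` is regular with
`P v` at the class representatives of its local components, then the family is NORMALISED AT
`toAdelic γ` OFF A FINITE SET: `∃ S₀, IsNormalisedOff L N H mG (toAdelic γ) S₀`
(`(mG v).atPoint γ_v (π K_v) = 1` for `v ∉ S₀`). [cite: Rogawski1990, §4.3 (p. 43)] -/
theorem exists_isNormalisedOff_of_isCanonical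
    (P : ∀ v : HeightOneSpectrum (𝓞 ↥(maximalRealSubfield L)), (cmDatum L N H).Local v → Prop)
    (νG : ∀ v : HeightOneSpectrum (𝓞 ↥(maximalRealSubfield L)), Measure ((cmDatum L N H).Local v))
    [∀ v, (νG v).IsHaarMeasure] [∀ v, (νG v).IsMulRightInvariant]
    (hν : ∀ v, νG v (cmLocalIntegralLevel L N H v) = 1)
    (mG : ∀ v : HeightOneSpectrum (𝓞 ↥(maximalRealSubfield L)), OrbitalMeasureFamily ((cmDatum L N H).Local v))
    (hcan : ∀ v, (mG v).IsCanonical (P v) (νG v))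
    (hF : CompactCoreCentralizerLevelAE L N H)
    (γ : (cmDatum L N H).Rational) (hγ : Rogawski1990.IsRegularElt (γ.val : GL (Fin N) L))
    (hP : ∀ v, P v (Quotient.out (ConjClasses.mk ((cmDatum L N H).toLocal v ((cmDatum L N H).toAdelic γ))))) :
    ∃ S₀ : Finset (HeightOneSpectrum (𝓞 ↥(maximalRealSubfield L))),
      IsNormalisedOff L N H mG ((cmDatum L N H).toAdelic γ) S₀ := by
  have hcof := hF γ hγ
  rw [Filter.eventually_cofinite] at hcof
  refine ⟨hcof.toFinset, fun v hv => ?_⟩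
  have hv' : compactCore (Subgroup.centralizer
      ({(cmDatum L N H).toLocal v ((cmDatum L N H).toAdelic γ)} : Set ((cmDatum L N H).Local v))) ⊆
        Subtype.val ⁻¹' (cmLocalIntegralLevel L N H v : Set ((cmDatum L N H).Local v)) := by
    by_contra hnot
    exact hv (hcof.mem_toFinset.2 hnot)
  obtain ⟨hKc, hKo⟩ := isCompact_isOpen_cmLocalIntegralLevel L N H v
  exact (hcan v).atPoint_image_mk_eq_one _ (hP v) (cmLocalIntegralLevel L N H v) hKo hKc (hν v) hv'

end UnitaryGroup

end Literature.NumberTheory.Automorphic
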